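import Mathlib.Algebra.QuadraticDiscriminant
import Literature.Analysis.Complex.JensenPolynomialHyperbolicity
import Literature.Analysis.Complex.JensenPolynomialSector
import HarnessLib

/-!
# The lone quadratic: the Jensen polynomials of `F(w) = (w + K²)² + ε²` and the sharpness of the
# sector theorem (all proved)

Trunk T-CA (`Literature/Analysis/Complex`), namespace `Literature.Analysis.Complex.JensenLoneQuad`.
The sector theorem of Obreschkoff type used by Chasse and Kim–Lee ([KimLee2021, Remark after
Thm. 3]; [Chasse2013, Thm. 1.8] as printed in [Farmer2022, §4]; tree:
`Literature.Analysis.Complex.Obreschkoff.splits_jensenPoly_taylor_of_zeros_mem_sector`) says: if a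
real entire function `F` of order `< 1` with `F(0) ≠ 0` has all its zeros in the double sector
`{|Im z| ≤ δ‖z‖}` (`Literature.Analysis.Complex.Obreschkoff.sector δ`), then the Jensen polynomial
`J^{d,0}` of its Taylor data (`Literature.NumberTheory.LFunctions.jensenPoly`, [GORZPNAS2019, §1]) is
hyperbolic whenever `d·δ² ≤ 1`.

This file computes the simplest instance EXACTLY and shows that the constant `1` is attained: for
ONE conjugate pair and nothing else, `F(w) = (w + K²)² + ε²` (zeros `-K² ± iε`, on the boundary of
the sector `δ₀ = |ε|/√(K⁴ + ε²)`), the Jensen polynomial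
`J^{d,0}(X) = (K⁴+ε²) + 2dK²·X + d(d-1)·X²` is hyperbolic if and only if `d·ε² ≤ K⁴ + ε²`, i.e.
iff `d·δ₀² ≤ 1` (`splits_jensenPoly_loneQuad_iff`). RH-free; nothing here concerns `ξ`.

## Contents (all proved; one auxiliary non-Prop definition)

* `loneQuadCoeff K ε` — the Taylor data `γ₀ = K⁴+ε²`, `γ₁ = 2K²`, `γ₂ = 2`, `γⱼ = 0` (`j ≥ 3`).
* `aeval_jensenPoly_loneQuad` — `J^{d,0}(z) = (K⁴+ε²) + 2dK²·z + d(d-1)·z²` for every `d`.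
* `splits_jensenPoly_loneQuad_iff` — hyperbolic iff `d·ε² ≤ K⁴ + ε²` (`ε ≠ 0`).

Provenance: cell rh-jensen (D-0074 GROUP I, negation lens round 2, `NegationLensR2Sketch.lean` §P2,
planner-rh-jensen-idea-2-g2-0, 2026-08-26: the sea-less case of the «detection-degree law», whose
heuristic log-heat-flow reading `t* = Δ²/2`, `Δ = ε/K²`, lives in the cell memo and is not used
here), landed by prover-rh-jensen-eng-2-g2-0. AI-produced formalisation; AI review is weaker than
expert review.

## References
* [KimLee2021] Y.-O. Kim, J. Lee, arXiv:2105.05386 (= JKMS 59 (2022)), Thm. 3 and the Remark after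
  it (the sector form), Thm. 4.
* [Chasse2013] M. Chasse, Complex Var. Elliptic Equ. 58 (2013) 875–885, Thm. 1.8 (through
  [Farmer2022] D. W. Farmer, Adv. Math. 411 (2022), §4).
* [GORZPNAS2019] M. Griffin, K. Ono, L. Rolen, D. Zagier, PNAS 116 (2019) 11103–11110, §1.
-/

open Polynomial Complex Filter Topology Metric Set
open scoped ComplexConjugate Nat

namespace Literature.Analysis.Complex.JensenLoneQuad

open Literature.NumberTheory.LFunctions Literature.Analysis.Complex.PolyaSchur
  Literature.Analysis.Complex

/-- Taylor data `γⱼ = F⁽ʲ⁾(0)` of `F(w) = (w + K²)² + ε² = (K⁴+ε²) + 2K²·w + w²` (non-Prop plumbing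
definition). [folklore] -/
def loneQuadCoeff (K ε : ℝ) : ℕ → ℝ
  | 0 => K ^ 4 + ε ^ 2
  | 1 => 2 * K ^ 2
  | 2 => 2
  | _ => 0

/-- `γⱼ = 0` for `j ≥ 3`. [folklore] -/
private theorem loneQuadCoeff_of_three_le (K ε : ℝ) {j : ℕ} (hj : 3 ≤ j) : loneQuadCoeff K ε j = 0 := by
  match j, hj with
  | j + 3, _ => rfl

/-- `J^{d,0}(z) = (K⁴+ε²) + 2dK²·z + d(d-1)·z²` for every `d` (also `d = 0, 1`): the Jensen
polynomial of the lone quadratic, from the definition of `J^{d,n}`. [cite: GORZPNAS2019, §1 (definition of J^{d,n})] -/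
theorem aeval_jensenPoly_loneQuad (K ε : ℝ) (d : ℕ) (z : ℂ) :
    aeval z (jensenPoly (loneQuadCoeff K ε) d 0) =
      ((d : ℂ) * ((d : ℂ) - 1)) * (z * z) + (2 * (d : ℂ) * (K : ℂ) ^ 2) * z
        + ((K : ℂ) ^ 4 + (ε : ℂ) ^ 2) := by
  have hexp : aeval z (jensenPoly (loneQuadCoeff K ε) d 0) =
      ∑ j ∈ Finset.range (d + 1), ((d.choose j : ℝ) : ℂ) * (loneQuadCoeff K ε j : ℂ) * z ^ j := by
    simp only [jensenPoly, map_sum, map_mul, aeval_C, map_pow, aeval_X, zero_add,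
      Complex.coe_algebraMap, Complex.ofReal_natCast]
  have h1 : ∑ j ∈ Finset.range (d + 1), ((d.choose j : ℝ) : ℂ) * (loneQuadCoeff K ε j : ℂ) * z ^ j =
      ∑ j ∈ Finset.range (d + 3), ((d.choose j : ℝ) : ℂ) * (loneQuadCoeff K ε j : ℂ) * z ^ j := by
    refine Finset.sum_subset (Finset.range_subset_range.2 (by omega)) fun j _ hj => ?_
    have hdj : d < j := by simpa using hj
    simp [Nat.choose_eq_zero_of_lt hdj]
  have h2 : ∑ j ∈ Finset.range 3, ((d.choose j : ℝ) : ℂ) * (loneQuadCoeff K ε j : ℂ) * z ^ j =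
      ∑ j ∈ Finset.range (d + 3), ((d.choose j : ℝ) : ℂ) * (loneQuadCoeff K ε j : ℂ) * z ^ j := by
    refine Finset.sum_subset (Finset.range_subset_range.2 (by omega)) fun j _ hj => ?_
    have h3j : 3 ≤ j := by simpa using hj
    simp [loneQuadCoeff_of_three_le K ε h3j]
  rw [hexp, h1, ← h2]
  have hc2 : ((d.choose 2 : ℕ) : ℂ) = (d : ℂ) * ((d : ℂ) - 1) / 2 := by
    have h := Nat.cast_choose_two ℂ d
    simpa using h
  simp only [Finset.sum_range_succ, Finset.sum_range_zero, zero_add, Nat.choose_zero_right, Nat.choose_one_right,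
    Nat.cast_one, one_mul, pow_zero, mul_one, pow_one, loneQuadCoeff,
    Complex.ofReal_add, Complex.ofReal_pow, Complex.ofReal_mul, Complex.ofReal_ofNat,
    Complex.ofReal_natCast]
  rw [hc2]
  ring

/-- Casting the real discriminant to `ℂ`. [folklore] -/
private theorem discrim_ofReal (a b c : ℝ) :
    discrim (a : ℂ) (b : ℂ) (c : ℂ) = ((discrim a b c : ℝ) : ℂ) := by
  simp only [discrim]; push_cast; ring

/-- **The lone quadratic.** `J^{d,0}` of `F(w) = (w+K²)² + ε²` (`ε ≠ 0`) is hyperbolic iff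
`d·ε² ≤ K⁴ + ε²`. Since the zeros `-K² ± iε` lie on the boundary of the sector
`{|Im z| ≤ δ₀‖z‖}`, `δ₀² = ε²/(K⁴+ε²)`, this says: hyperbolic iff `d·δ₀² ≤ 1` — the constant of the
sector theorem (`splits_jensenPoly_taylor_of_zeros_mem_sector`: zeros in the sector `δ` ⇒ `J^{d,0}`
hyperbolic for `d·δ² ≤ 1`) is attained by an isolated pair. RH-free, exact.
[cite: KimLee2021, Remark after Theorem 3 (sector theorem; sharpness of the constant)]
[cite: Chasse2013, Theorem 1.8] -/
theorem splits_jensenPoly_loneQuad_iff (K ε : ℝ) (hε : ε ≠ 0) (d : ℕ) :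
    (jensenPoly (loneQuadCoeff K ε) d 0).Splits ↔ (d : ℝ) * ε ^ 2 ≤ K ^ 4 + ε ^ 2 := by
  have hc : 0 < K ^ 4 + ε ^ 2 := by positivity
  -- the polynomial is non-zero: its value at `0` is `K⁴ + ε² > 0`
  have hp0 : jensenPoly (loneQuadCoeff K ε) d 0 ≠ 0 := by
    intro h0
    have h := aeval_jensenPoly_loneQuad K ε d 0
    rw [h0, map_zero] at h
    have : ((K ^ 4 + ε ^ 2 : ℝ) : ℂ) = 0 := by push_cast; rw [h]; ring
    exact hc.ne' (by exact_mod_cast this)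
  rw [splits_iff_forall_aeval_eq_zero_im_eq_zero, or_iff_right hp0]
  -- abbreviations: `a z² + b z + c`
  set a : ℝ := (d : ℝ) * ((d : ℝ) - 1) with ha
  set b : ℝ := 2 * (d : ℝ) * K ^ 2 with hb
  set c : ℝ := K ^ 4 + ε ^ 2 with hcdef
  have hev : ∀ z : ℂ, aeval z (jensenPoly (loneQuadCoeff K ε) d 0) =
      (a : ℂ) * (z * z) + (b : ℂ) * z + (c : ℂ) := by
    intro z; rw [aeval_jensenPoly_loneQuad, ha, hb, hcdef]; push_cast; ring
  -- the discriminant `b² - 4ac = 4d (K⁴ + ε² - d ε²)`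
  have hdisc : discrim a b c = 4 * (d : ℝ) * (K ^ 4 + ε ^ 2 - (d : ℝ) * ε ^ 2) := by
    rw [discrim, ha, hb, hcdef]; ring
  constructor
  · -- all roots real ⇒ the condition; else exhibit a root with non-zero imaginary part
    intro hreal
    by_contra hlt
    push Not at hlt
    have hd2 : (2 : ℝ) ≤ d := by
      by_contra hd
      push Not at hd
      have hd1 : (d : ℝ) ≤ 1 := by
        have : d < 2 := by exact_mod_cast hd
        exact_mod_cast (Nat.lt_succ_iff.1 this)
      nlinarith [sq_nonneg ε, sq_nonneg (K ^ 2)]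
    have ha0 : a ≠ 0 := by rw [ha]; nlinarith
    have hdpos : (0 : ℝ) < d := by linarith
    set D : ℝ := -discrim a b c with hD
    have hDpos : 0 < D := by rw [hD, hdisc]; nlinarith
    set s : ℂ := Complex.I * Real.sqrt D with hs
    have hsq : ((Real.sqrt D : ℝ) : ℂ) * (Real.sqrt D : ℂ) = (D : ℂ) := by
      rw [← Complex.ofReal_mul, Real.mul_self_sqrt hDpos.le]
    have hss : discrim (a : ℂ) b c = s * s := by
      have : discrim (a : ℂ) b c = ((discrim a b c : ℝ) : ℂ) := discrim_ofReal a b c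
      rw [this, hs]
      calc ((discrim a b c : ℝ) : ℂ) = -(D : ℂ) := by rw [hD]; push_cast; ring
        _ = Complex.I * Complex.I * ((Real.sqrt D : ℂ) * (Real.sqrt D : ℂ)) := by
            rw [hsq, Complex.I_mul_I]; ring
        _ = Complex.I * ↑(Real.sqrt D) * (Complex.I * ↑(Real.sqrt D)) := by ring
    have ha0' : (a : ℂ) ≠ 0 := by exact_mod_cast ha0
    set x : ℂ := (-(b : ℂ) + s) / (2 * a) with hx
    have hroot : aeval x (jensenPoly (loneQuadCoeff K ε) d 0) = 0 := by
      rw [hev]; exact (quadratic_eq_zero_iff ha0' hss x).2 (Or.inl rfl)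
    have him := hreal x hroot
    have h2a : (2 * (a : ℂ)) = ((2 * a : ℝ) : ℂ) := by push_cast; ring
    rw [hx, h2a, Complex.div_ofReal_im] at him
    have hnum : (-(b : ℂ) + s).im = Real.sqrt D := by simp [hs]
    rw [hnum] at him
    have hsD : 0 < Real.sqrt D := Real.sqrt_pos.2 hDpos
    rcases div_eq_zero_iff.1 him with h | h
    · exact hsD.ne' h
    · exact ha0 (by linarith)
  · -- the condition ⇒ every complex root is real
    intro hle z hz
    rw [hev] at hz
    by_cases ha0 : a = 0
    · -- degree ≤ 1: `b z + c = 0`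
      rw [ha0] at hz
      simp only [Complex.ofReal_zero, zero_mul, zero_add] at hz
      by_cases hb0 : b = 0
      · rw [hb0] at hz; simp at hz; exact absurd (by exact_mod_cast hz : c = 0) hc.ne'
      · have hz' : z = -(c : ℂ) / (b : ℂ) := by
          have hb0' : (b : ℂ) ≠ 0 := by exact_mod_cast hb0
          field_simp at hz ⊢
          linear_combination hz
        rw [hz', ← Complex.ofReal_neg, ← Complex.ofReal_div, Complex.ofReal_im]
    · have hdnn : (0 : ℝ) ≤ d := Nat.cast_nonneg d
      have hDnn : 0 ≤ discrim a b c := by rw [hdisc]; nlinarith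
      set s : ℝ := Real.sqrt (discrim a b c) with hs
      have hss : discrim (a : ℂ) b c = (s : ℂ) * (s : ℂ) := by
        have : discrim (a : ℂ) b c = ((discrim a b c : ℝ) : ℂ) := discrim_ofReal a b c
        rw [this, ← Complex.ofReal_mul, hs, Real.mul_self_sqrt hDnn]
      have ha0' : (a : ℂ) ≠ 0 := by exact_mod_cast ha0
      rcases (quadratic_eq_zero_iff ha0' hss z).1 hz with h | h
      · rw [h, show (-(b : ℂ) + s) / (2 * a) = (((-b + s) / (2 * a) : ℝ) : ℂ) by push_cast; ring,
          Complex.ofReal_im]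
      · rw [h, show (-(b : ℂ) - s) / (2 * a) = (((-b - s) / (2 * a) : ℝ) : ℂ) by push_cast; ring,
          Complex.ofReal_im]

/-! ## Sharpness of the sector theorem's constant (appended 2026-08-26)

The hypotheses of the tree's sector theorem
`Literature.Analysis.Complex.Obreschkoff.splits_jensenPoly_taylor_of_zeros_mem_sector`
(real entire `F` of order `< 1`, `F(0) ≠ 0`, all zeros in the sector `{|Im z| ≤ δ‖z‖}`) give the
hyperbolicity of `J^{d,0}` for `d·δ² ≤ 1`. The lone quadratic shows the constant `1` cannot be
enlarged: for every degree `d` and every `K`, `ε ≠ 0` with `d·ε² > K⁴ + ε²` the quadratic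
`F(w) = (w + K²)² + ε²` satisfies all the hypotheses with `δ₀ = |ε|/√(K⁴+ε²)`, `d·δ₀² > 1`, and its
`J^{d,0}` is NOT hyperbolic (`sector_constant_sharp`). -/

open Literature.Analysis.TotalPositivity Literature.Analysis.Complex.Obreschkoff

/-- The derivative of `w ↦ (w + c)² + e`. [folklore] -/
private theorem deriv_loneQuadF (c e : ℂ) :
    deriv (fun w : ℂ => (w + c) ^ 2 + e) = fun w => 2 * (w + c) := by
  funext w
  have h : HasDerivAt (fun w : ℂ => (w + c) ^ 2 + e) (2 * (w + c)) w := by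
    have h1 := ((hasDerivAt_id w).add_const c).pow 2
    simpa using h1.add_const e
  exact h.deriv

/-- The second derivative of `w ↦ (w + c)² + e` is the constant `2`. [folklore] -/
private theorem deriv_deriv_loneQuadF (c e : ℂ) :
    deriv (deriv (fun w : ℂ => (w + c) ^ 2 + e)) = fun _ => (2 : ℂ) := by
  rw [deriv_loneQuadF]
  funext w
  have h : HasDerivAt (fun w : ℂ => 2 * (w + c)) 2 w := by
    simpa using ((hasDerivAt_id w).add_const c).const_mul (2 : ℂ)
  exact h.deriv

/-- The Taylor data of `F(w) = (w + K²)² + ε²` at `0` is `loneQuadCoeff K ε`: `(K⁴+ε², 2K², 2, 0, 0, …)`.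
[folklore] -/
private theorem iteratedDeriv_loneQuadF_re (K ε : ℝ) (k : ℕ) :
    (iteratedDeriv k (fun w : ℂ => (w + (K : ℂ) ^ 2) ^ 2 + (ε : ℂ) ^ 2) 0).re = loneQuadCoeff K ε k := by
  match k with
  | 0 =>
    simp only [iteratedDeriv_zero, loneQuadCoeff, zero_add]
    norm_cast; ring
  | 1 =>
    rw [iteratedDeriv_one, deriv_loneQuadF]
    simp only [loneQuadCoeff, zero_add]
    norm_cast
  | 2 =>
    rw [show (2 : ℕ) = 1 + 1 from rfl, iteratedDeriv_succ', iteratedDeriv_one, deriv_deriv_loneQuadF]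
    simp [loneQuadCoeff]
  | k + 3 =>
    rw [show k + 3 = (k + 1) + 1 + 1 from rfl, iteratedDeriv_succ', iteratedDeriv_succ',
      deriv_deriv_loneQuadF]
    have h0 : iteratedDeriv (k + 1) (fun _ : ℂ => (2 : ℂ)) 0 = 0 := by
      rw [iteratedDeriv_const]; simp
    rw [h0, loneQuadCoeff_of_three_le K ε (by omega)]; simp

/-- `F(w) = (w + K²)² + ε²` is a real entire function of order `< 1` (indeed a polynomial):
`‖F(z)‖ ≤ (48 + 2K⁴ + ε²)·exp(‖z‖^{1/2})`. [folklore] -/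
private theorem isEntireOfOrderLtOne_loneQuadF (K ε : ℝ) :
    IsEntireOfOrderLtOne (fun w : ℂ => (w + (K : ℂ) ^ 2) ^ 2 + (ε : ℂ) ^ 2) := by
  refine ⟨by fun_prop, 1 / 2, 48 + 2 * K ^ 4 + ε ^ 2, by norm_num, fun z => ?_⟩
  have hx : 0 ≤ ‖z‖ ^ (1 / 2 : ℝ) := by positivity
  have hexp1 : 1 ≤ Real.exp (‖z‖ ^ (1 / 2 : ℝ)) := Real.one_le_exp hx
  have hexp4 : (‖z‖ ^ (1 / 2 : ℝ)) ^ 4 / (4 ! : ℕ) ≤ Real.exp (‖z‖ ^ (1 / 2 : ℝ)) :=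
    @Real.pow_div_factorial_le_exp (‖z‖ ^ (1 / 2 : ℝ)) hx 4
  have hsq : (‖z‖ ^ (1 / 2 : ℝ)) ^ 4 = ‖z‖ ^ 2 := by
    rw [← Real.rpow_natCast, ← Real.rpow_mul (norm_nonneg z)]; norm_num
  rw [hsq] at hexp4
  have h24 : ‖z‖ ^ 2 ≤ 24 * Real.exp (‖z‖ ^ (1 / 2 : ℝ)) := by
    have : ((4 ! : ℕ) : ℝ) = 24 := by norm_num [Nat.factorial]
    rw [this] at hexp4
    linarith [hexp4]
  have hK : ‖(K : ℂ) ^ 2‖ = K ^ 2 := by rw [norm_pow, Complex.norm_real, Real.norm_eq_abs, sq_abs]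
  have hε : ‖(ε : ℂ) ^ 2‖ = ε ^ 2 := by rw [norm_pow, Complex.norm_real, Real.norm_eq_abs, sq_abs]
  calc ‖(z + (K : ℂ) ^ 2) ^ 2 + (ε : ℂ) ^ 2‖
      ≤ ‖(z + (K : ℂ) ^ 2) ^ 2‖ + ‖(ε : ℂ) ^ 2‖ := norm_add_le _ _
    _ = ‖z + (K : ℂ) ^ 2‖ ^ 2 + ε ^ 2 := by rw [norm_pow, hε]
    _ ≤ (‖z‖ + K ^ 2) ^ 2 + ε ^ 2 := by
        gcongr
        calc ‖z + (K : ℂ) ^ 2‖ ≤ ‖z‖ + ‖(K : ℂ) ^ 2‖ := norm_add_le _ _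
          _ = ‖z‖ + K ^ 2 := by rw [hK]
    _ ≤ 2 * ‖z‖ ^ 2 + 2 * K ^ 4 + ε ^ 2 := by nlinarith [sq_nonneg (‖z‖ - K ^ 2)]
    _ ≤ (48 + 2 * K ^ 4 + ε ^ 2) * Real.exp (‖z‖ ^ (1 / 2 : ℝ)) := by
        nlinarith [h24, hexp1, sq_nonneg K, sq_nonneg ε, mul_nonneg (by positivity : (0:ℝ) ≤ 2 * K ^ 4 + ε ^ 2) (sub_nonneg.mpr hexp1)]

/-- The zeros of `(w + K²)² + ε²` are `−K² ± iε`; they lie in (indeed on the boundary of) the sector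
`{|Im z| ≤ δ₀‖z‖}`, `δ₀ = |ε|/√(K⁴+ε²)`. [folklore] -/
private theorem loneQuadF_zero_mem_sector (K ε : ℝ) {z : ℂ}
    (hz : (z + (K : ℂ) ^ 2) ^ 2 + (ε : ℂ) ^ 2 = 0) :
    z ∈ sector (|ε| / Real.sqrt (K ^ 4 + ε ^ 2)) := by
  have hsq : (z + (K : ℂ) ^ 2) ^ 2 = (Complex.I * ε) ^ 2 := by
    rw [mul_pow, Complex.I_sq]; linear_combination hz
  have hz' : z = -(K : ℂ) ^ 2 + Complex.I * ε ∨ z = -(K : ℂ) ^ 2 - Complex.I * ε := by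
    rcases sq_eq_sq_iff_eq_or_eq_neg.mp hsq with h | h
    · left; linear_combination h
    · right; linear_combination h
  have hK2 : ((K : ℂ) ^ 2).im = 0 := by rw [← Complex.ofReal_pow]; exact Complex.ofReal_im _
  have hK2re : ((K : ℂ) ^ 2).re = K ^ 2 := by rw [← Complex.ofReal_pow]; exact Complex.ofReal_re _
  have him : |z.im| = |ε| := by
    rcases hz' with h | h <;> · rw [h]; simp [hK2]
  have hnorm : ‖z‖ = Real.sqrt (K ^ 4 + ε ^ 2) := by
    have hns : Complex.normSq z = K ^ 4 + ε ^ 2 := by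
      rcases hz' with h | h <;> · rw [h]; simp [Complex.normSq_apply, hK2, hK2re]; ring
    rw [Complex.norm_def, hns]
  rw [mem_sector, him, hnorm]
  by_cases h0 : Real.sqrt (K ^ 4 + ε ^ 2) = 0
  · have hε0 : ε = 0 := by
      have h1 : K ^ 4 + ε ^ 2 ≤ 0 := Real.sqrt_eq_zero'.mp h0
      nlinarith [sq_nonneg ε, sq_nonneg (K ^ 2)]
    simp [hε0]
  · rw [div_mul_cancel₀ _ h0]

/-- **The constant of the sector theorem is sharp.** For every degree `d` and all real `K`, `ε ≠ 0`
with `d·ε² > K⁴ + ε²`, the quadratic `F(w) = (w + K²)² + ε²` is a real entire function of order `< 1`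
with `F(0) ≠ 0`, all of whose zeros lie in the sector `{|Im z| ≤ δ₀‖z‖}`, `δ₀ = |ε|/√(K⁴+ε²)`, with
`d·δ₀² > 1` — and its Jensen polynomial `J^{d,0}` (Taylor data `(F⁽ᵏ⁾(0))ₖ = loneQuadCoeff K ε`) is NOT
hyperbolic. So in `splits_jensenPoly_taylor_of_zeros_mem_sector` the hypothesis `d·δ² ≤ 1` cannot be
replaced by `d·δ² ≤ 1 + η` for any `η > 0` (take `K = 0`-free families with `d·δ₀²` just above `1`).
[cite: KimLee2021, Remark after Theorem 3 (sector theorem; sharpness of the constant)]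
[cite: Chasse2013, Theorem 1.8] -/
theorem sector_constant_sharp (K ε : ℝ) (hε : ε ≠ 0) {d : ℕ} (hd : K ^ 4 + ε ^ 2 < (d : ℝ) * ε ^ 2) :
    IsEntireOfOrderLtOne (fun w : ℂ => (w + (K : ℂ) ^ 2) ^ 2 + (ε : ℂ) ^ 2) ∧
    (∀ z : ℂ, (fun w : ℂ => (w + (K : ℂ) ^ 2) ^ 2 + (ε : ℂ) ^ 2) (conj z) =
      conj ((fun w : ℂ => (w + (K : ℂ) ^ 2) ^ 2 + (ε : ℂ) ^ 2) z)) ∧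
    (fun w : ℂ => (w + (K : ℂ) ^ 2) ^ 2 + (ε : ℂ) ^ 2) 0 ≠ 0 ∧
    (∀ z : ℂ, (fun w : ℂ => (w + (K : ℂ) ^ 2) ^ 2 + (ε : ℂ) ^ 2) z = 0 →
      z ∈ sector (|ε| / Real.sqrt (K ^ 4 + ε ^ 2))) ∧
    1 < (d : ℝ) * (|ε| / Real.sqrt (K ^ 4 + ε ^ 2)) ^ 2 ∧
    ¬ (jensenPoly (fun k => (iteratedDeriv k (fun w : ℂ => (w + (K : ℂ) ^ 2) ^ 2 + (ε : ℂ) ^ 2) 0).re)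
        d 0).Splits := by
  have hc : 0 < K ^ 4 + ε ^ 2 := by positivity
  refine ⟨isEntireOfOrderLtOne_loneQuadF K ε, fun z => ?_, ?_, fun z hz => loneQuadF_zero_mem_sector K ε hz,
    ?_, ?_⟩
  · simp only [map_add, map_pow, Complex.conj_ofReal]
  · show ((0 : ℂ) + (K : ℂ) ^ 2) ^ 2 + (ε : ℂ) ^ 2 ≠ 0
    intro h
    have : ((K ^ 4 + ε ^ 2 : ℝ) : ℂ) = 0 := by push_cast; linear_combination h
    exact hc.ne' (by exact_mod_cast this)
  · rw [div_pow, sq_abs, Real.sq_sqrt hc.le, ← mul_div_assoc, one_lt_div hc]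
    exact hd
  · have hfun : (fun k => (iteratedDeriv k (fun w : ℂ => (w + (K : ℂ) ^ 2) ^ 2 + (ε : ℂ) ^ 2) 0).re) =
        loneQuadCoeff K ε := funext (iteratedDeriv_loneQuadF_re K ε)
    rw [hfun, splits_jensenPoly_loneQuad_iff K ε hε d]
    linarith

end Literature.Analysis.Complex.JensenLoneQuad
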